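import Mathlib
import Literature.Computability.AlgebraicComplexity.DetInVP
import Literature.Computability.AlgebraicComplexity.IMMInVPProofs
import Literature.Computability.AlgebraicComplexity.ArithCircuitProofs
import Literature.Computability.AlgebraicComplexity.ValiantClassesProofs
import HarnessLib

/-!
# Crux `DivisionGap.ZeroOneTransfer` (stmt-ValiantsHypothesis-5066), line `charged-uncharged` —
stub `stub_dimerFamilyVP`, support file 1: generic bookkeeping

Elementary facts used to glue Kasteleyn's determinant identity, a Kasteleyn sign function and
"square roots are cheap" into `D_n ∈ VP_ℂ` for the perfect-matching family of the triangular
rhombus (Valiant 1980, §3 Thm. 2):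

* `dimerVP_filter_fpfInvol_eq_empty_of_odd` — a finite type of odd cardinality has no
  fixed-point-free involution (so odd levels of the family vanish; the registered sub-goal);
* `sum_fpfInvol_prod_ite` — half-weights `η u v = if A u v then w u v else 0` turn the sum over ALL
  fixed-point-free involutions into the sum over the `A`-adjacent ones;
* `complexity_det_le` — `L(det M) ≤ 8 (#V + 1)⁷ + Σ L(M u v)` for a square matrix of polynomials on
  any finite index type (`DET ∈ VP`, `complexity_detPoly_le`, transported along `V ≃ Fin #V`, plus
  the substitution bound `complexity_aeval_le`);
* translation by a base point: `constantCoeff_aeval_X_add_C`, `aeval_X_sub_C_aeval_X_add_C`,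
  `complexity_aeval_X_add_C_le`, `complexity_aeval_X_sub_C_le`, and the consequence of "square
  roots are cheap" (the statement of stub `stub_sqrtCheap`, a hypothesis here) at a base point
  with value `1`: `complexity_le_of_sq`;
* total degree of (translated) graph polynomials: `totalDegree_aeval_sum_prod_X_le`.
[folklore]
-/

set_option linter.dupNamespace false

namespace Summit.ValiantsHypothesis.ValiantsHypothesis.Theorems.DivisionGapZeroOneTransfer

open Finset MvPolynomial Literature.Computability.AlgebraicComplexity

/-- A finite type of odd cardinality carries no fixed-point-free involution: the route's filter of
fixed-point-free `A`-adjacent involutions (the summation range of the perfect-matching polynomial)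
is empty — so the odd levels of the dimer family vanish.  Registered sub-goal of stub
`stub_dimerFamilyVP` (closed form, fully qualified). [folklore] -/
theorem dimerVP_filter_fpfInvol_eq_empty_of_odd :
    ∀ (V : Type) [Fintype V] [DecidableEq V] (A : V → V → Prop) [∀ u v, Decidable (A u v)], Odd (Fintype.card V) → (Finset.univ : Finset (V → V)).filter (fun f => ∀ v, f (f v) = v ∧ f v ≠ v ∧ A v (f v)) = ∅ := by
  intro V _ _ A _ hodd
  refine Finset.filter_eq_empty_iff.mpr fun f _ hf => ?_
  set σ : Equiv.Perm V := Function.Involutive.toPerm f fun v => (hf v).1 with hσ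
  have h2 : σ ^ 2 = 1 := by
    ext v
    simp [sq, hσ, (hf v).1]
  have hsupp : σ.support = univ :=
    Finset.eq_univ_iff_forall.mpr fun v => Equiv.Perm.mem_support.mpr (hf v).2.1
  have h := Equiv.Perm.two_dvd_card_support h2
  rw [hsupp, Finset.card_univ] at h
  exact (Nat.not_even_iff_odd.mpr hodd) (even_iff_two_dvd.mpr h)

namespace DimerFamilyVP

noncomputable section

section Involutions

variable {V : Type} [Fintype V] [DecidableEq V]

/-- Half-weights supported on `A` (`if A u v then w u v else 0`): the sum over all fixed-point-free
involutions of `Π_v η v (f v)` is the sum over the `A`-adjacent ones of `Π_v w v (f v)`.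
[folklore] -/
theorem sum_fpfInvol_prod_ite (A : V → V → Prop) [∀ u v, Decidable (A u v)] {R : Type*}
    [CommSemiring R] (w : V → V → R) :
    ∑ f ∈ (univ : Finset (V → V)).filter (fun f => ∀ v, f (f v) = v ∧ f v ≠ v),
        ∏ v, (if A v (f v) then w v (f v) else 0) =
      ∑ f ∈ (univ : Finset (V → V)).filter (fun f => ∀ v, f (f v) = v ∧ f v ≠ v ∧ A v (f v)),
        ∏ v, w v (f v) := by
  have hfilter : (univ : Finset (V → V)).filter (fun f => ∀ v, f (f v) = v ∧ f v ≠ v ∧ A v (f v)) =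
      ((univ : Finset (V → V)).filter (fun f => ∀ v, f (f v) = v ∧ f v ≠ v)).filter
        (fun f => ∀ v, A v (f v)) := by
    rw [Finset.filter_filter]
    refine Finset.filter_congr fun f _ => ?_
    simp only [forall_and, and_assoc]
  rw [hfilter, Finset.sum_filter (fun f : V → V => ∀ v, A v (f v))]
  refine Finset.sum_congr rfl fun f _ => ?_
  split_ifs with h
  · exact Finset.prod_congr rfl fun v _ => if_pos (h v)
  · obtain ⟨v, hv⟩ := not_forall.mp h
    exact Finset.prod_eq_zero (Finset.mem_univ v) (if_neg hv)

end Involutions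

section DetCost

variable {V : Type} [Fintype V] [DecidableEq V] {k : Type} [CommRing k] {τ : Type}

/-- `L(det M) ≤ 8 (#V + 1)⁷ + Σ_{u,v} L(M u v)`: the determinant of a matrix of polynomials is the
generic determinant `DET_{#V}` (`L ≤ 8 (#V+1)⁷`, Berkowitz) with the entries substituted
(`complexity_aeval_le`). [cite: Burgisser2000, Prop. 2.30] -/
theorem complexity_det_le (M : Matrix V V (MvPolynomial τ k)) :
    complexity M.det ≤ 8 * (Fintype.card V + 1) ^ 7 + ∑ q : V × V, complexity (M q.1 q.2) := by
  set m := Fintype.card V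
  set e : V ≃ Fin m := Fintype.equivFin V
  have hdet : M.det = (M.submatrix e.symm e.symm).det :=
    (Matrix.det_submatrix_equiv_self e.symm M).symm
  have haeval : (M.submatrix e.symm e.symm).det =
      aeval (fun q : Fin m × Fin m => M (e.symm q.1) (e.symm q.2)) (detPoly (Fin m) k) := by
    rw [detPoly, AlgHom.map_det, AlgHom.mapMatrix_apply]
    congr 1
    ext i j
    simp [Matrix.mvPolynomialX_apply]
  rw [hdet, haeval]
  refine (complexity_aeval_le _ _).trans (Nat.add_le_add (complexity_detPoly_le k m) (le_of_eq ?_))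
  exact Fintype.sum_equiv (e.symm.prodCongr e.symm) _ _ fun q => rfl

/-- A decided `X`-or-`0` entry is free. [folklore] -/
theorem complexity_ite_X_zero {R : Type} [CommSemiring R] (P : Prop) [Decidable P] (i : τ) :
    complexity (if P then (X i : MvPolynomial τ R) else 0) = 0 := by
  split_ifs
  · exact complexity_X_holds i
  · rw [← C_0]; exact complexity_C_holds (0 : R)

/-- `L(C c * p * q) ≤ 2` when `p`, `q` are free. [folklore] -/
theorem complexity_C_mul_mul_le {R : Type} [CommSemiring R] (c : R) (p q : MvPolynomial τ R)
    (hp : complexity p = 0) (hq : complexity q = 0) : complexity (C c * p * q) ≤ 2 := by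
  calc complexity (C c * p * q) ≤ complexity (C c * p) + complexity q + 1 :=
        complexity_mul_le_holds _ _
    _ ≤ (complexity (C c) + complexity p + 1) + complexity q + 1 := by
        gcongr; exact complexity_mul_le_holds _ _
    _ = 2 := by rw [complexity_C_holds, hp, hq]

end DetCost

section Translation

variable {k : Type} [CommRing k] {τ : Type}

/-- The constant coefficient of the translate `p(X + a)` is the value `p(a)`. [folklore] -/
theorem constantCoeff_aeval_X_add_C (a : τ → k) (p : MvPolynomial τ k) :
    constantCoeff (aeval (fun i => (X i : MvPolynomial τ k) + C (a i)) p) = eval a p := by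
  have h : constantCoeff.comp (aeval (fun i => (X i : MvPolynomial τ k) + C (a i))).toRingHom =
      eval a := by
    refine ringHom_ext (fun r => ?_) (fun i => ?_)
    · simp
    · simp
  exact RingHom.congr_fun h p

/-- Translating back: `(p(X + a))(X - a) = p`. [folklore] -/
theorem aeval_X_sub_C_aeval_X_add_C (a : τ → k) (p : MvPolynomial τ k) :
    aeval (fun i => (X i : MvPolynomial τ k) - C (a i))
      (aeval (fun i => (X i : MvPolynomial τ k) + C (a i)) p) = p := by
  rw [← AlgHom.comp_apply, comp_aeval]
  have h : (fun i => aeval (fun i => (X i : MvPolynomial τ k) - C (a i))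
      ((X i : MvPolynomial τ k) + C (a i))) = X := by
    funext i
    simp
  rw [h]
  exact aeval_X_left_apply p

/-- `L(X i + C c) ≤ 1`. [folklore] -/
theorem complexity_X_add_C_le (i : τ) (c : k) :
    complexity ((X i : MvPolynomial τ k) + C c) ≤ 1 := by
  calc complexity ((X i : MvPolynomial τ k) + C c) ≤ complexity (X i : MvPolynomial τ k) +
        complexity (C c : MvPolynomial τ k) + 1 := complexity_add_le_holds _ _
    _ = 1 := by rw [complexity_X_holds, complexity_C_holds]

/-- `L(X i - C c) ≤ 1`. [folklore] -/
theorem complexity_X_sub_C_le (i : τ) (c : k) :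
    complexity ((X i : MvPolynomial τ k) - C c) ≤ 1 := by
  rw [sub_eq_add_neg, ← C_neg]
  exact complexity_X_add_C_le i (-c)

variable [Fintype τ]

/-- Translation costs at most one gate per variable: `L(p(X + a)) ≤ L(p) + #τ`. [folklore] -/
theorem complexity_aeval_X_add_C_le (a : τ → k) (p : MvPolynomial τ k) :
    complexity (aeval (fun i => (X i : MvPolynomial τ k) + C (a i)) p) ≤
      complexity p + Fintype.card τ := by
  refine (complexity_aeval_le _ _).trans (Nat.add_le_add_left ?_ _)
  calc ∑ i, complexity ((X i : MvPolynomial τ k) + C (a i)) ≤ ∑ _i : τ, 1 :=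
        Finset.sum_le_sum fun i _ => complexity_X_add_C_le i (a i)
    _ = Fintype.card τ := by simp

/-- Translation back costs at most one gate per variable: `L(p(X - a)) ≤ L(p) + #τ`. [folklore] -/
theorem complexity_aeval_X_sub_C_le (a : τ → k) (p : MvPolynomial τ k) :
    complexity (aeval (fun i => (X i : MvPolynomial τ k) - C (a i)) p) ≤
      complexity p + Fintype.card τ := by
  refine (complexity_aeval_le _ _).trans (Nat.add_le_add_left ?_ _)
  calc ∑ i, complexity ((X i : MvPolynomial τ k) - C (a i)) ≤ ∑ _i : τ, 1 :=
        Finset.sum_le_sum fun i _ => complexity_X_sub_C_le i (a i)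
    _ = Fintype.card τ := by simp

/-- **Cheap square roots at a base point** (hypothesis `H3` = stub `stub_sqrtCheap`, transported
to a base point `a` with `D(a) = 1`): `L(D) ≤ (L(D²) + #τ + d + #τ + 2)¹² + #τ`, where `d` bounds
the total degree of the translate `D(X + a)` — translate, take the square root, translate back.
[cite: Valiant1980, §3 Thm. 2] -/
theorem complexity_le_of_sq
    (H3 : ∀ (τ : Type) [Fintype τ] (f : MvPolynomial τ ℂ), MvPolynomial.constantCoeff f = 1 →
      complexity f ≤ (complexity (f ^ 2) + f.totalDegree + Fintype.card τ + 2) ^ 12)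
    (D : MvPolynomial τ ℂ) (a : τ → ℂ) (d : ℕ) (heval : eval a D = 1)
    (hdeg : (aeval (fun i => (X i : MvPolynomial τ ℂ) + C (a i)) D).totalDegree ≤ d) :
    complexity D ≤ (complexity (D ^ 2) + Fintype.card τ + d + Fintype.card τ + 2) ^ 12 +
      Fintype.card τ := by
  set F := aeval (fun i => (X i : MvPolynomial τ ℂ) + C (a i)) D with hF
  have hF0 : constantCoeff F = 1 := by rw [hF, constantCoeff_aeval_X_add_C, heval]
  have hF2 : complexity (F ^ 2) ≤ complexity (D ^ 2) + Fintype.card τ := by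
    rw [hF, ← map_pow]
    exact complexity_aeval_X_add_C_le _ _
  have hFc := H3 τ F hF0
  calc complexity D = complexity (aeval (fun i => (X i : MvPolynomial τ ℂ) - C (a i)) F) := by
        rw [hF, aeval_X_sub_C_aeval_X_add_C]
    _ ≤ complexity F + Fintype.card τ := complexity_aeval_X_sub_C_le _ _
    _ ≤ (complexity (F ^ 2) + F.totalDegree + Fintype.card τ + 2) ^ 12 + Fintype.card τ :=
        Nat.add_le_add_right hFc _
    _ ≤ (complexity (D ^ 2) + Fintype.card τ + d + Fintype.card τ + 2) ^ 12 +
          Fintype.card τ := by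
        gcongr

end Translation

section Degree

variable {V : Type} [Fintype V] {k : Type} [CommRing k] {τ : Type} {W : Type}

/-- Substituting polynomials of total degree `≤ 1` into a graph polynomial
`Σ_{f ∈ S} Π_v X (v, f v)` gives total degree `≤ #V`. [folklore] -/
theorem totalDegree_aeval_sum_prod_X_le (S : Finset (V → W)) (g : V × W → MvPolynomial τ k)
    (hg : ∀ i, (g i).totalDegree ≤ 1) :
    (aeval g (∑ f ∈ S, ∏ v : V, (X (v, f v) : MvPolynomial (V × W) k))).totalDegree ≤
      Fintype.card V := by
  rw [map_sum]
  refine (totalDegree_finsetSum _ _).trans (Finset.sup_le fun f _ => ?_)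
  rw [map_prod]
  refine (totalDegree_finsetProd _ _).trans ?_
  calc ∑ v, (aeval g (X (v, f v) : MvPolynomial (V × W) k)).totalDegree ≤ ∑ _v : V, 1 :=
        Finset.sum_le_sum fun v _ => by rw [aeval_X]; exact hg _
    _ = Fintype.card V := by simp

/-- `X i + C c` has total degree `≤ 1`. [folklore] -/
theorem totalDegree_X_add_C_le [Nontrivial k] (i : τ) (c : k) :
    ((X i : MvPolynomial τ k) + C c).totalDegree ≤ 1 := by
  refine (totalDegree_add _ _).trans (max_le (totalDegree_X i).le ?_)
  rw [totalDegree_C]; exact Nat.zero_le _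

end Degree

end

end DimerFamilyVP

end Summit.ValiantsHypothesis.ValiantsHypothesis.Theorems.DivisionGapZeroOneTransfer
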